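import Literature.AnabelianGeometry.EtaleTheta.ContH1Lemmas
import Literature.AnabelianGeometry.EtaleTheta.ContH1ConjAction
import Mathlib.Topology.Algebra.OpenSubgroup
import Mathlib.GroupTheory.Index
import Mathlib.GroupTheory.QuotientGroup.Basic

/-!
# The divisibility level of a conjugation-stable family of cocycles (generic support file)

S. Mochizuki, *Inter-universal Teichmüller theory II*, kurims manuscript (Dec. 2020), Prop. 1.4 p. 27 /
Prop. 2.2 (ii) p. 66 (`N`-th roots of the classes of `θ(Π)` in `lim_J H¹(Π_Ÿ(Π)|_J, (l·Δ_Θ)(Π))`, `J` the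
finite-index open subgroups of `Π`) [claim: Mochizuki2012, status: disputed]. abc-iut cell, layer L6, node
IUTchII:Prop2.2(ii), row Prop-22.ii.r13a input "hdiv" (abc-iut-w5-d187); companion of
`CohomologyLimitDivisible.lean` (roots of cocycles). Classical group cohomology [cite: NeukirchSchmidtWingberg2008, I §2 and II §7]:
for continuous cocycles `H → A` (`ContH1`, abc-iut-L2-t1), a subgroup `K ≤ G` acting trivially on `A` modulo a
subgroup `A_M ≤ A` (in the application: the `M`-th powers), and a family `𝒞` of cocycles on a NORMAL `H ⊴ G`
stable under the conjugation action of `G` (`ContH1.conjCocycle`):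

* `DivisibleLevel.levelOne c` — the subgroup of `g ∈ H ∩ K` with `c(g) ∈ A_M` (a subgroup because `K` acts
  trivially mod `A_M`); open when `H`, `K`, `A_M` are (`isOpen_levelOne`); of finite index in `H` when `K` has
  finite index in `G` and `A_M` in `A` (`finiteIndex_levelOne`, via the homomorphism `H ∩ K → A/A_M`);
* `DivisibleLevel.level 𝒞 = (H ∩ K) ∩ ⋂_{c ∈ 𝒞} levelOne c` — NORMAL in `G` when `𝒞` is conjugation-stable and
  `A_M` is characteristic under the conjugations (`level_normal`): the mechanism by which a divisibility level
  of the orbit of ONE class becomes one of the `Π`-normal subgroups that are cofinal in [IUTchII] Prop. 1.4's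
  index system (`EtaleThetaDataOfSettingCofinal.lean`); open and of finite index in `H` as soon as `𝒞` has
  FINITELY MANY MEMBERS MODULO `A_M` on `H ∩ K` (hypothesis `hfin`; `isOpen_level`, `finiteIndex_level`).

Auxiliary definitions only (`levelOne`, `level`); nothing of [IUTchII]/[EtTh] asserted; no side taken on
[IUTchIII] Cor. 3.12.
-/

namespace Literature.IUT.HodgeArakelov

open Literature.AnabelianGeometry.EtaleTheta Topology

noncomputable section

namespace DivisibleLevel

variable {G G' : Type*} [Group G] [TopologicalSpace G]
  [Group G'] [TopologicalSpace G'] [IsTopologicalGroup G']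
  {φ : G →* G'} {A : Subgroup G'} [A.Normal] [IsMulCommutative A] {H : Subgroup G}
  {K : Subgroup G} {AM : Subgroup A}

open scoped IsMulCommutative

/-! ### The level of one cocycle -/

/-- **The divisibility level of one cocycle** `c : H → A` relative to `K` and `A_M`: the `g ∈ H ∩ K` with
`c(g) ∈ A_M` — a subgroup, because `K` acts trivially on `A` modulo `A_M` (`hK`).
[cite: NeukirchSchmidtWingberg2008, I §2 and II §7] -/
def levelOne (c : contCocycles φ A H) (hK : ∀ g ∈ K, ∀ b : A, MulAut.conjNormal (φ g) b * b⁻¹ ∈ AM) :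
    Subgroup G where
  carrier := {g | ∃ hg : g ∈ H ⊓ K, c.1 ⟨g, (Subgroup.mem_inf.mp hg).1⟩ ∈ AM}
  one_mem' := ⟨one_mem _, by
    have h : c.1 ⟨1, (Subgroup.mem_inf.mp (one_mem (H ⊓ K))).1⟩ = c.1 1 := rfl
    rw [h, ContH1.cocycle_map_one]
    exact one_mem _⟩
  mul_mem' := by
    rintro a b ⟨ha, hca⟩ ⟨hb, hcb⟩
    refine ⟨mul_mem ha hb, ?_⟩
    have e : (⟨a * b, (Subgroup.mem_inf.mp (mul_mem ha hb)).1⟩ : H) =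
        ⟨a, (Subgroup.mem_inf.mp ha).1⟩ * ⟨b, (Subgroup.mem_inf.mp hb).1⟩ := rfl
    rw [e, c.2.2]
    refine mul_mem hca ?_
    rw [← inv_mul_cancel_right (MulAut.conjNormal _ _) (c.1 ⟨b, (Subgroup.mem_inf.mp hb).1⟩)]
    exact mul_mem (hK a (Subgroup.mem_inf.mp ha).2 _) hcb
  inv_mem' := by
    rintro a ⟨ha, hca⟩
    refine ⟨inv_mem ha, ?_⟩
    set σ : H := ⟨a, (Subgroup.mem_inf.mp ha).1⟩ with hσ
    have e : (⟨a⁻¹, (Subgroup.mem_inf.mp (inv_mem ha)).1⟩ : H) = σ⁻¹ := rfl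
    have hinv := ContH1.conjNormal_apply_map_inv c σ
    have h2 : c.1 σ⁻¹ = MulAut.conjNormal (φ a⁻¹) (MulAut.conjNormal (φ (σ : G)) (c.1 σ⁻¹)) := by
      rw [← MulAut.mul_apply, ← map_mul, ← map_mul, hσ, inv_mul_cancel, map_one, map_one, MulAut.one_apply]
    rw [e, h2, hinv, ← inv_mul_cancel_right (MulAut.conjNormal _ _) (c.1 σ)⁻¹]
    exact mul_mem (hK a⁻¹ (Subgroup.mem_inf.mp (inv_mem ha)).2 _) (inv_mem hca)

variable {hK : ∀ g ∈ K, ∀ b : A, MulAut.conjNormal (φ g) b * b⁻¹ ∈ AM}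

/-- Membership in the level of one cocycle. [cite: NeukirchSchmidtWingberg2008, I §2 and II §7] -/
theorem mem_levelOne {c : contCocycles φ A H} {g : G} :
    g ∈ levelOne c hK ↔ ∃ hg : g ∈ H ⊓ K, c.1 ⟨g, (Subgroup.mem_inf.mp hg).1⟩ ∈ AM :=
  Iff.rfl

/-- The level lies in `H ∩ K`. [cite: NeukirchSchmidtWingberg2008, I §2 and II §7] -/
theorem levelOne_le (c : contCocycles φ A H) : levelOne c hK ≤ H ⊓ K := fun _ hg => hg.1

/-- The level of a continuous cocycle is OPEN when `H`, `K` and `A_M ⊆ A` are open.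
[cite: NeukirchSchmidtWingberg2008, I §2 and II §7] -/
theorem isOpen_levelOne (c : contCocycles φ A H) (hHo : IsOpen (H : Set G)) (hKo : IsOpen (K : Set G))
    (hAMo : IsOpen (AM : Set A)) : IsOpen (levelOne c hK : Set G) := by
  have hU : IsOpen {σ : H | (σ : G) ∈ K ∧ c.1 σ ∈ AM} :=
    (hKo.preimage continuous_subtype_val).inter (hAMo.preimage c.2.1)
  have heq : (levelOne c hK : Set G) = Subtype.val '' {σ : H | (σ : G) ∈ K ∧ c.1 σ ∈ AM} := by
    ext g
    constructor
    · rintro ⟨hg, hc⟩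
      exact ⟨⟨g, (Subgroup.mem_inf.mp hg).1⟩, ⟨(Subgroup.mem_inf.mp hg).2, hc⟩, rfl⟩
    · rintro ⟨σ, ⟨hσK, hσc⟩, rfl⟩
      exact ⟨Subgroup.mem_inf.mpr ⟨σ.2, hσK⟩, hσc⟩
  rw [heq]
  exact hHo.isOpenMap_subtype_val _ hU

/-- The level of a cocycle has FINITE INDEX in `H` when `K` has finite index in `G` and `A_M` in `A`: it is
the kernel of the homomorphism `H ∩ K → A/A_M`, `g ↦ c(g)` (a homomorphism as `K` acts trivially mod `A_M`).
[cite: NeukirchSchmidtWingberg2008, I §2 and II §7] -/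
theorem finiteIndex_levelOne (c : contCocycles φ A H) [K.FiniteIndex] (hAM : AM.FiniteIndex) :
    ((levelOne c hK).subgroupOf H).FiniteIndex := by
  -- the reduction homomorphism `H ∩ K → A/A_M`
  let red : ↥(H ⊓ K) →* A ⧸ AM :=
    { toFun := fun g => QuotientGroup.mk (c.1 ⟨g, (Subgroup.mem_inf.mp g.2).1⟩)
      map_one' := by
        have h : c.1 ⟨((1 : ↥(H ⊓ K)) : G), (Subgroup.mem_inf.mp (1 : ↥(H ⊓ K)).2).1⟩ = c.1 1 := rfl
        rw [h, ContH1.cocycle_map_one]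
        rfl
      map_mul' := fun a b => by
        have e : (⟨((a * b : ↥(H ⊓ K)) : G), (Subgroup.mem_inf.mp (a * b).2).1⟩ : H) =
            ⟨a, (Subgroup.mem_inf.mp a.2).1⟩ * ⟨b, (Subgroup.mem_inf.mp b.2).1⟩ := rfl
        rw [e, c.2.2, QuotientGroup.mk_mul]
        congr 1
        apply QuotientGroup.eq.mpr
        rw [← inv_mem_iff, mul_inv_rev, inv_inv, mul_comm]
        exact hK _ (Subgroup.mem_inf.mp a.2).2 _ }
  have hker : red.ker = (levelOne c hK).subgroupOf (H ⊓ K) := by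
    ext g
    rw [MonoidHom.mem_ker, Subgroup.mem_subgroupOf, mem_levelOne]
    change (QuotientGroup.mk _ : A ⧸ AM) = 1 ↔ _
    rw [QuotientGroup.eq_one_iff]
    exact ⟨fun h => ⟨g.2, h⟩, fun ⟨_, h⟩ => h⟩
  -- finite index in `H ∩ K`
  haveI : Finite (A ⧸ AM) := Subgroup.finite_quotient_of_finiteIndex
  have h1 : ((levelOne c hK).subgroupOf (H ⊓ K)).FiniteIndex := by
    rw [← hker]
    refine ⟨?_⟩
    rw [Subgroup.index_ker]
    haveI : Finite red.range := inferInstance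
    exact Nat.card_pos.ne'
  -- finite index in `H`
  refine ⟨?_⟩
  change (levelOne c hK).relIndex H ≠ 0
  rw [← Subgroup.relIndex_mul_relIndex (levelOne c hK) (H ⊓ K) H (levelOne_le c) inf_le_left,
    Subgroup.inf_relIndex_left]
  exact mul_ne_zero h1.1 (Subgroup.instFiniteIndex_subgroupOf K H).1

/-! ### The level of a family -/

/-- **The divisibility level of a family** `𝒞` of cocycles: `(H ∩ K) ∩ ⋂_{c ∈ 𝒞} levelOne c`.
[cite: NeukirchSchmidtWingberg2008, I §2 and II §7] -/
def level (𝒞 : Set (contCocycles φ A H)) (hK : ∀ g ∈ K, ∀ b : A, MulAut.conjNormal (φ g) b * b⁻¹ ∈ AM) :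
    Subgroup G :=
  (H ⊓ K) ⊓ ⨅ c : 𝒞, levelOne c.1 hK

/-- Membership in the level of a family. [cite: NeukirchSchmidtWingberg2008, I §2 and II §7] -/
theorem mem_level {𝒞 : Set (contCocycles φ A H)} {g : G} :
    g ∈ level 𝒞 hK ↔ g ∈ H ⊓ K ∧ ∀ c ∈ 𝒞, g ∈ levelOne c hK := by
  rw [level, Subgroup.mem_inf, Subgroup.mem_iInf]
  exact ⟨fun ⟨h1, h2⟩ => ⟨h1, fun c hc => h2 ⟨c, hc⟩⟩, fun ⟨h1, h2⟩ => ⟨h1, fun c => h2 c.1 c.2⟩⟩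

/-- The level of a family lies in `H`. [cite: NeukirchSchmidtWingberg2008, I §2 and II §7] -/
theorem level_le_left (𝒞 : Set (contCocycles φ A H)) : level 𝒞 hK ≤ H :=
  fun _ hg => (Subgroup.mem_inf.mp (mem_level.mp hg).1).1

/-- On the level every member of the family takes values in `A_M`. [cite: NeukirchSchmidtWingberg2008, I §2 and II §7] -/
theorem apply_mem_of_mem_level {𝒞 : Set (contCocycles φ A H)} {c : contCocycles φ A H} (hc : c ∈ 𝒞)
    (g : H) (hg : (g : G) ∈ level 𝒞 hK) : c.1 g ∈ AM := by
  obtain ⟨_, h⟩ := mem_levelOne.mp ((mem_level.mp hg).2 c hc)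
  exact h

/-- **The level of a CONJUGATION-STABLE family on a normal `H` is NORMAL in `G`** (for `K` normal and `A_M`
stable under the conjugations `MulAut.conjNormal x`, `x ∈ G'` — e.g. the `M`-th powers): conjugating
`g ∈ level 𝒞` by `τ` and evaluating `c ∈ 𝒞` gives `φ(τ) · (τ⁻¹·c)(g) · φ(τ)⁻¹` with `τ⁻¹·c ∈ 𝒞`.
[cite: NeukirchSchmidtWingberg2008, I §2 and II §7] -/
theorem level_normal [IsTopologicalGroup G] [hHn : H.Normal] [hKn : K.Normal] {𝒞 : Set (contCocycles φ A H)}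
    (hstab : ∀ σ : G, ∀ c ∈ 𝒞, ContH1.conjCocycle φ A σ c ∈ 𝒞)
    (hAMc : ∀ x : G', ∀ a : A, a ∈ AM → MulAut.conjNormal x a ∈ AM) : (level 𝒞 hK).Normal := by
  refine ⟨fun n hn τ => ?_⟩
  rw [mem_level] at hn ⊢
  obtain ⟨hnHK, hnc⟩ := hn
  haveI : (H ⊓ K).Normal := Subgroup.normal_inf_normal H K
  have hτn : τ * n * τ⁻¹ ∈ H ⊓ K := (inferInstance : (H ⊓ K).Normal).conj_mem n hnHK τ
  refine ⟨hτn, fun c hc => mem_levelOne.mpr ⟨hτn, ?_⟩⟩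
  -- `c(τ n τ⁻¹) = φ(τ) · (τ⁻¹·c)(n) · φ(τ)⁻¹`
  obtain ⟨_, hc'⟩ := mem_levelOne.mp (hnc _ (hstab τ⁻¹ c hc))
  have happ := ContH1.conjCocycle_apply (φ := φ) (A := A) τ⁻¹ c ⟨n, (Subgroup.mem_inf.mp hnHK).1⟩
  have e : MulAut.conjNormal τ⁻¹⁻¹ (⟨n, (Subgroup.mem_inf.mp hnHK).1⟩ : H) =
      ⟨τ * n * τ⁻¹, (Subgroup.mem_inf.mp hτn).1⟩ :=
    Subtype.ext (by simp only [inv_inv, MulAut.conjNormal_apply])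
  rw [e] at happ
  have key : c.1 ⟨τ * n * τ⁻¹, (Subgroup.mem_inf.mp hτn).1⟩ =
      MulAut.conjNormal (φ τ) ((ContH1.conjCocycle φ A τ⁻¹ c).1 ⟨n, (Subgroup.mem_inf.mp hnHK).1⟩) := by
    rw [happ, ← MulAut.mul_apply, ← map_mul, ← map_mul, mul_inv_cancel, map_one, map_one, MulAut.one_apply]
  rw [key]
  exact hAMc _ _ hc'

/-- If `𝒞` HAS FINITELY MANY MEMBERS MODULO `A_M` ON `H ∩ K` (finitely many functions `H → A` represent
every member of `𝒞` up to `A_M` at the elements of `K` — hypothesis `hfin`), the level of the family is a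
FINITE intersection of levels of members. [cite: NeukirchSchmidtWingberg2008, I §2 and II §7] -/
theorem exists_finset_level_eq (hK : ∀ g ∈ K, ∀ b : A, MulAut.conjNormal (φ g) b * b⁻¹ ∈ AM)
    {𝒞 : Set (contCocycles φ A H)}
    (hfin : ∃ T : Finset (H → A), ∀ c ∈ 𝒞, ∃ t ∈ T, ∀ g : H, (g : G) ∈ K → (t g)⁻¹ * c.1 g ∈ AM) :
    ∃ F : Finset (contCocycles φ A H), ↑F ⊆ 𝒞 ∧ level 𝒞 hK = (H ⊓ K) ⊓ ⨅ c ∈ F, levelOne c hK := by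
  classical
  obtain ⟨T, hT⟩ := hfin
  -- for each representative `t` pick a member of `𝒞` it represents (if any)
  have hw : ∀ t : H → A, ∃ c : contCocycles φ A H,
      (∃ c' ∈ 𝒞, ∀ g : H, (g : G) ∈ K → (t g)⁻¹ * c'.1 g ∈ AM) →
        c ∈ 𝒞 ∧ ∀ g : H, (g : G) ∈ K → (t g)⁻¹ * c.1 g ∈ AM := by
    intro t
    by_cases h : ∃ c' ∈ 𝒞, ∀ g : H, (g : G) ∈ K → (t g)⁻¹ * c'.1 g ∈ AM
    · obtain ⟨c', hc', h'⟩ := h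
      exact ⟨c', fun _ => ⟨hc', h'⟩⟩
    · exact ⟨1, fun h' => (h h').elim⟩
  choose w hw using hw
  let T' := T.filter fun t => ∃ c' ∈ 𝒞, ∀ g : H, (g : G) ∈ K → (t g)⁻¹ * c'.1 g ∈ AM
  refine ⟨T'.image w, ?_, le_antisymm ?_ ?_⟩
  · intro c hc
    obtain ⟨t, ht, rfl⟩ := Finset.mem_image.mp hc
    exact (hw t (Finset.mem_filter.mp ht).2).1
  · intro g hg
    rw [mem_level] at hg
    refine Subgroup.mem_inf.mpr ⟨hg.1, Subgroup.mem_iInf.mpr fun c => Subgroup.mem_iInf.mpr fun hc => ?_⟩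
    obtain ⟨t, ht, rfl⟩ := Finset.mem_image.mp hc
    exact hg.2 _ (hw t (Finset.mem_filter.mp ht).2).1
  · intro g hg
    obtain ⟨hgHK, hgF⟩ := Subgroup.mem_inf.mp hg
    rw [mem_level]
    refine ⟨hgHK, fun c hc => mem_levelOne.mpr ⟨hgHK, ?_⟩⟩
    obtain ⟨t, htT, htc⟩ := hT c hc
    have ht' : t ∈ T' := Finset.mem_filter.mpr ⟨htT, c, hc, htc⟩
    have hwt := hw t (Finset.mem_filter.mp ht').2
    have hgw : g ∈ levelOne (w t) hK :=
      Subgroup.mem_iInf.mp (Subgroup.mem_iInf.mp hgF (w t)) (Finset.mem_image_of_mem w ht')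
    obtain ⟨_, hgw'⟩ := mem_levelOne.mp hgw
    set σ : H := ⟨g, (Subgroup.mem_inf.mp hgHK).1⟩
    have h1 : (t σ)⁻¹ * (w t).1 σ ∈ AM := hwt.2 σ (Subgroup.mem_inf.mp hgHK).2
    have h2 : (t σ)⁻¹ * c.1 σ ∈ AM := htc σ (Subgroup.mem_inf.mp hgHK).2
    have e : c.1 σ = (w t).1 σ * ((t σ)⁻¹ * (w t).1 σ)⁻¹ * ((t σ)⁻¹ * c.1 σ) := by group
    rw [e]
    exact mul_mem (mul_mem hgw' (inv_mem h1)) h2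

/-- The level of a family with finitely many members mod `A_M` is OPEN (when `H`, `K`, `A_M` are).
[cite: NeukirchSchmidtWingberg2008, I §2 and II §7] -/
theorem isOpen_level {𝒞 : Set (contCocycles φ A H)}
    (hfin : ∃ T : Finset (H → A), ∀ c ∈ 𝒞, ∃ t ∈ T, ∀ g : H, (g : G) ∈ K → (t g)⁻¹ * c.1 g ∈ AM) (hHo : IsOpen (H : Set G))
    (hKo : IsOpen (K : Set G)) (hAMo : IsOpen (AM : Set A)) : IsOpen (level 𝒞 hK : Set G) := by
  obtain ⟨F, -, hF⟩ := exists_finset_level_eq hK hfin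
  rw [hF, Subgroup.coe_inf, Subgroup.coe_iInf]
  refine (hHo.inter hKo).inter ?_
  simp only [Subgroup.coe_iInf]
  exact isOpen_biInter_finset fun c _ => isOpen_levelOne c hHo hKo hAMo

/-- The level of a family with finitely many members mod `A_M` has FINITE INDEX in `H` (when `K` has finite
index in `G` and `A_M` in `A`). [cite: NeukirchSchmidtWingberg2008, I §2 and II §7] -/
theorem finiteIndex_level {𝒞 : Set (contCocycles φ A H)}
    (hfin : ∃ T : Finset (H → A), ∀ c ∈ 𝒞, ∃ t ∈ T, ∀ g : H, (g : G) ∈ K → (t g)⁻¹ * c.1 g ∈ AM) [K.FiniteIndex]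
    (hAM : AM.FiniteIndex) : ((level 𝒞 hK).subgroupOf H).FiniteIndex := by
  obtain ⟨F, -, hF⟩ := exists_finset_level_eq hK hfin
  rw [hF, Subgroup.subgroupOf, Subgroup.comap_inf]
  simp only [Subgroup.comap_iInf]
  haveI : ((H ⊓ K).comap H.subtype).FiniteIndex := by
    change ((H ⊓ K).subgroupOf H).FiniteIndex
    refine ⟨?_⟩
    change (H ⊓ K).relIndex H ≠ 0
    rw [Subgroup.inf_relIndex_left]
    exact (Subgroup.instFiniteIndex_subgroupOf K H).1
  haveI : (⨅ c ∈ F, (levelOne c hK).comap H.subtype).FiniteIndex :=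
    Subgroup.finiteIndex_iInf' (fun c => (levelOne c hK).comap H.subtype)
      fun c _ => finiteIndex_levelOne c hAM
  infer_instance

end DivisibleLevel

end

end Literature.IUT.HodgeArakelov
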